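import Literature.AlgebraicGeometry.ShimuraVarieties.UnitaryAuxiliarySpecialPairSpan
import Literature.AlgebraicGeometry.ShimuraVarieties.UnitaryAuxiliaryComplexStructureFrame
import Literature.NumberTheory.ComplexMultiplication.CMTypeDistinguishedElementReflexField
import HarnessLib

/-!
# The special pair of a line: `(c_B, J_{β,Φ}(x))` is special with CM types `(Φ; Φ, Φ, Φ^τ̄)`

[Deligne1971TravauxShimura] 4.18, 5.11 / [Deligne1979ShimuraVarieties] Prop. 2.3.10 / [Milne2005ShimuraVarieties] Def. 12.5,
Rem. 12.6 p. 113, Ex. 12.4 (b) p. 112.  For an `H^j`-orthogonal `M`-frame `B` of `V_M` through the negative line of the ball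
point `x` (at the embeddings over `τ`), the CM structure `c_B` of the frame (★ `exists_cmStructure_of_orthogonal`) and the
complex structure `J_{β,Φ}(x)` (★ `auxComplexStructure`, ★ `auxPoint`) form a SPECIAL PAIR (★ `CMStructure.IsSpecial`) whose
CM types are `Φ` on `W₀` and on the lines `M b₁`, `M b₂`, and the SWAPPED type `Φ^τ̄ = (Φ ∖ {ρ|_L = τ}) ∪ {ρ|_L = τ̄}` on the
line `M b₃` (`isSpecial_of_frame_spec_of_line`; the swapped type exists by `exists_cmType_swap`, and its reflex field lies in any number
field containing `E*(Φ)` and `τ(L)`, `traceField_le_of_swap`).  Inputs: the geometric core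
★ `blockGL_iPhi_sPhi_mul_frame_eq` (`UnitaryAuxiliaryComplexStructureFrame`) and the span identity
★ `auxComplexStructure_eq_sum_actMatrix` (`UnitaryAuxiliarySpecialPairSpan`).  This is the special pair through which
[Deligne1971TravauxShimura] 5.11–5.12 reads the reciprocity law of the canonical model at the special points of a line.
-/

noncomputable section

open Matrix NumberField
open scoped TensorProduct ComplexConjugate Classical

namespace Literature.AlgebraicGeometry.ShimuraVarieties.UnitaryCanonicalModel.Aux

open Literature.AlgebraicGeometry.ModuliOfAbelianVarieties
open Literature.Geometry.ComplexHyperbolic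
open Literature.NumberTheory.Automorphic (formCongr formCongr_star)
open Literature.NumberTheory.ComplexMultiplication (traceField traceField_le_iff_forall_smul_mem_iff_of_finiteDimensional
  ringEquiv_smul_apply)

section ReflexField

open scoped Literature.NumberTheory.ComplexMultiplication

/-- **The reflex field of the swapped type is contained in any number field containing `E*(Φ)` and `τ(L)`**: for a CM
field `L` (so `τ̄(L) = τ(L)`), every automorphism of `ℂ` fixing `E ⊇ E*(Φ) · τ(L)` pointwise stabilises `Φ`, the embeddings over
`τ` and those over `τ̄`, hence `Φ^τ̄ = (Φ ∖ {ρ|_L = τ}) ∪ {ρ|_L = τ̄}`; by the Galois correspondence for reflex fields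
(★ `traceField_le_iff_forall_smul_mem_iff_of_finiteDimensional`, [Shimura1998] §8.3 Prop. 28) `E*(Φ^τ̄) ⊆ E`.
[cite: Shimura1998, §8.3 Prop. 28] [cite: MilneCM2006, Ch. I §1] -/
theorem traceField_le_of_swap {L M : Type} [Field L] [NumberField L] [IsCMField L] [Field M] [NumberField M]
    (Φ Ψ : Literature.AlgebraicGeometry.Motives.CMType M) (τ : L →+* ℂ) (j : L →+* M)
    (hΨ : ∀ ρ : M →+* ℂ, ρ ∈ Ψ.1 ↔ (ρ ∈ Φ.1 ∧ ρ.comp j ≠ τ) ∨ ρ.comp j = ComplexEmbedding.conjugate τ)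
    (E : IntermediateField ℚ ℂ) [FiniteDimensional ℚ ↥E] (hE : ∀ x : L, τ x ∈ E) (hΦE : traceField Φ ≤ E) :
    traceField Ψ ≤ E := by
  rw [traceField_le_iff_forall_smul_mem_iff_of_finiteDimensional] at hΦE ⊢
  intro σ hσ χ
  have hΦ := hΦE σ hσ χ
  -- `σ` fixes `τ(L)` and `τ̄(L) = τ(c L)` pointwise
  have h1 : ∀ x : L, σ (τ x) = τ x := fun x => hσ _ (hE x)
  have hτ : (σ • χ).comp j = τ ↔ χ.comp j = τ := by
    constructor
    · intro h
      ext x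
      have hx := congrArg (fun f : L →+* ℂ => f x) h
      simp only [RingHom.coe_comp, Function.comp_apply, ringEquiv_smul_apply] at hx
      -- σ (χ (j x)) = τ x = σ (τ x)
      rw [← h1 x] at hx
      exact σ.injective hx
    · intro h
      ext x
      have hx := congrArg (fun f : L →+* ℂ => f x) h
      simp only [RingHom.coe_comp, Function.comp_apply] at hx
      simp only [RingHom.coe_comp, Function.comp_apply, ringEquiv_smul_apply, hx, h1]
  have hτbar : (σ • χ).comp j = ComplexEmbedding.conjugate τ ↔ χ.comp j = ComplexEmbedding.conjugate τ := by
    have h2 : ∀ x : L, σ (ComplexEmbedding.conjugate τ x) = ComplexEmbedding.conjugate τ x := by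
      intro x
      rw [ComplexEmbedding.conjugate_coe_eq, ← IsCMField.complexEmbedding_complexConj]
      exact h1 _
    constructor
    · intro h
      ext x
      have hx := congrArg (fun f : L →+* ℂ => f x) h
      simp only [RingHom.coe_comp, Function.comp_apply, ringEquiv_smul_apply] at hx
      rw [← h2 x] at hx
      exact σ.injective hx
    · intro h
      ext x
      have hx := congrArg (fun f : L →+* ℂ => f x) h
      simp only [RingHom.coe_comp, Function.comp_apply] at hx
      simp only [RingHom.coe_comp, Function.comp_apply, ringEquiv_smul_apply, hx, h2]
  rw [hΨ, hΨ, hΦ]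
  simp only [ne_eq]
  rw [hτ, hτbar]

end ReflexField

section SpecialPair

variable {L : Type} [Field L] {M : Type} [Field M] [NumberField M] [IsCMField M] {j : L →+* M}
  {H : Matrix (Fin 3) (Fin 3) L} {ξ₀ ξ : M} {g : ℕ} {δ : Fin g → ℕ}

omit [NumberField M] [IsCMField M] in
/-- **The swapped CM type `Φ^τ̄`**: replacing, in a CM type `Φ` of `M`, the embeddings over the complex embedding `τ` of `L`
by those over `τ̄` gives a CM type (the embeddings over `τ` all lie in `Φ` or the statement is about the set
`(Φ ∖ {ρ | ρ|_L = τ}) ∪ {ρ | ρ|_L = τ̄}` regardless). [cite: MilneCM2006, Ch. I §1] [cite: Deligne1979ShimuraVarieties, 2.3.9 (PDF p. 32)] -/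
theorem exists_cmType_swap (Φ : Literature.AlgebraicGeometry.Motives.CMType M) (τ : L →+* ℂ) (j : L →+* M)
    (hτ : ComplexEmbedding.conjugate τ ≠ τ) :
    ∃ Ψ : Literature.AlgebraicGeometry.Motives.CMType M, ∀ ρ : M →+* ℂ,
      ρ ∈ Ψ.1 ↔ (ρ ∈ Φ.1 ∧ ρ.comp j ≠ τ) ∨ ρ.comp j = ComplexEmbedding.conjugate τ := by
  have hinv := ComplexEmbedding.involutive_conjugate L
  refine ⟨⟨{ρ | (ρ ∈ Φ.1 ∧ ρ.comp j ≠ τ) ∨ ρ.comp j = ComplexEmbedding.conjugate τ}, fun φ => ?_⟩,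
    fun ρ => Iff.rfl⟩
  have h1 : (ComplexEmbedding.conjugate φ).comp j = ComplexEmbedding.conjugate (φ.comp j) := rfl
  have hΦ := Φ.2 φ
  simp only [Set.mem_setOf_eq, h1]
  constructor
  · rintro (⟨hφ, hne⟩ | heq)
    · rintro (⟨hc, _⟩ | hc)
      · exact hΦ.1 hφ hc
      · exact hne (hinv.injective hc)
    · rintro (⟨_, hne'⟩ | hc)
      · exact hne' (by rw [heq]; exact hinv τ)
      · have h2 := hinv.injective hc
        rw [h2] at heq
        exact hτ heq.symm
  · intro h
    rw [not_or] at h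
    obtain ⟨ha, hb⟩ := h
    have hne : φ.comp j ≠ τ := fun h' => hb (by rw [h'])
    by_cases hφ : φ ∈ Φ.1
    · exact Or.inl ⟨hφ, hne⟩
    · right
      have hc : ComplexEmbedding.conjugate φ ∈ Φ.1 := by
        by_contra hc
        exact hφ (hΦ.2 hc)
      have hd : ComplexEmbedding.conjugate (φ.comp j) = τ := by
        by_contra hd
        exact ha ⟨hc, hd⟩
      rw [← hd]
      exact (hinv _).symm


/-! ### The special pair of a line -/

/-- **THE SPECIAL PAIR OF A LINE** ([Deligne1971TravauxShimura] 4.18 and 5.11; [Deligne1979ShimuraVarieties] Prop. 2.3.10;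
[Milne2005ShimuraVarieties] Def. 12.5 / Rem. 12.6 p. 113, Ex. 12.4 (b) p. 112).  Let `B = (b₁|b₂|b₃) ∈ GL₃(M)` be an
`H^j`-ORTHOGONAL `M`-frame of `V_M` whose third vector spans the negative line of the ball point `x` at the embeddings of `M`
over `τ` (`T·lift x ∈ ℂˣ·ρ(b₃)`; for `B = b ⊗ 1` with `b` an `H`-orthogonal `L`-basis this is ★ `IsLinePoint L τ T b₃ x`), and
let `c` be the CM structure of the frame (★ `exists_cmStructure_of_orthogonal`: `x ∈ F = M^{1⊕3}` multiplies `diag(1,B)e_p`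
by `x_p`).  Then `(c, J_{β,Φ}(x))` is a SPECIAL PAIR (★ `CMStructure.IsSpecial`) with CM types `(Φ; Φ, Φ, Φ^τ̄)`:
`J` commutes with `F` (it is the image of `(i; i, i, i·ε) ∈ F ⊗ ℝ`), and on the `ρ`-eigenline of the `p`-th factor `J_ℂ` is
`+i` iff `ρ ∈ Φ` — except on the line factor `p = inr 2`, where the sign is flipped exactly over the place of `τ`
(`Φ^τ̄ = (Φ ∖ {ρ|_L = τ}) ∪ {ρ|_L = τ̄}`, any `Φ'` with these fibres; it exists by ★ `exists_cmType_swap`).  Hypotheses: the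
frame `Tᴴ H^τ T = diag(1,1,-1)` and `τ̄ ≠ τ`; `J` is any point of `C0pm δ` with matrix `auxComplexStructure F τ Φ T x`
(e.g. ★ `auxPoint`). [cite: Deligne1971TravauxShimura, 4.18 p. 150 and 5.11 p. 158] [cite: Deligne1979ShimuraVarieties, Prop. 2.3.10 (PDF p. 32)]
[cite: Milne2005ShimuraVarieties, Def. 12.5, Rem. 12.6 p. 113 and Ex. 12.4 (b) p. 112] -/
theorem isSpecial_of_frame_spec_of_line (F : SymplecticFrame M j H ξ₀ ξ g δ) (τ : L →+* ℂ)
    (Φ : Literature.AlgebraicGeometry.Motives.CMType M) (T : GL (Fin 3) ℂ)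
    (hT : formCongr (starRingEnd ℂ) T (H.map τ) = BallModel.J) (hτ : ComplexEmbedding.conjugate τ ≠ τ)
    (x : BallModel.Ball) (B : GL (Fin 3) M)
    (hB : ∀ k l : Fin 3, k ≠ l →
      (((B : Matrix (Fin 3) (Fin 3) M).map (IsCMField.complexConj M))ᵀ * H.map j * (B : Matrix (Fin 3) (Fin 3) M)) k l = 0)
    (hline : ∀ ρ : Φ.1, ρ.1.comp j = τ → ∃ c : ℂ, c ≠ 0 ∧
      (T : Matrix (Fin 3) (Fin 3) ℂ) *ᵥ BallModel.lift x = c • fun i => ρ.1 ((B : Matrix (Fin 3) (Fin 3) M) i 2))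
    (c : CMStructure g δ (Fin 1 ⊕ Fin 3) (fun _ => M))
    (hc : ∀ (y : Fin 1 ⊕ Fin 3 → M) (p : Fin 1 ⊕ Fin 3) (m : M),
      c.act y (F.β (m • ((blockGL M (1, B) : GL (Fin 1 ⊕ Fin 3) M) : Matrix (Fin 1 ⊕ Fin 3) (Fin 1 ⊕ Fin 3) M) *ᵥ
        Pi.single p 1)) =
        F.β ((y p * m) • ((blockGL M (1, B) : GL (Fin 1 ⊕ Fin 3) M) : Matrix (Fin 1 ⊕ Fin 3) (Fin 1 ⊕ Fin 3) M) *ᵥ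
          Pi.single p 1))
    (J : C0pm δ) (hJ : (J : Matrix (Fin g ⊕ Fin g) (Fin g ⊕ Fin g) ℝ) = auxComplexStructure F τ Φ T x)
    (Φ' : Fin 1 ⊕ Fin 3 → Literature.AlgebraicGeometry.Motives.CMType M) (hΦ'₁ : ∀ p, p ≠ Sum.inr 2 → Φ' p = Φ)
    (hΦ'₂ : ∀ ρ : M →+* ℂ, ρ ∈ (Φ' (Sum.inr 2)).1 ↔
      (ρ ∈ Φ.1 ∧ ρ.comp j ≠ τ) ∨ ρ.comp j = ComplexEmbedding.conjugate τ) :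
    c.IsSpecial J Φ' := by
  have hinv := ComplexEmbedding.involutive_conjugate L
  have hT' : ((T : Matrix (Fin 3) (Fin 3) ℂ))ᴴ * H.map τ * (T : Matrix (Fin 3) (Fin 3) ℂ) = BallModel.J := by
    rwa [formCongr_star] at hT
  have hu := blockGL_iPhi_sPhi_mul_frame_eq M j H Φ τ T hT' x B hB hline
  set u : Fin 1 ⊕ Fin 3 → ℝ ⊗[ℚ] M := fun p => iPhiVal M Φ *
    Sum.elim (fun _ => (1 : ℝ ⊗[ℚ] M))
      (fun k => if k = 2 then (realPiEquiv M Φ).symm (fun φ => if φ.1.comp j = τ then (-1 : ℂ) else 1) else 1) p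
    with hu_def
  -- the `Φ`-components of `u`
  have hval0 : ∀ (φ : Φ.1) (p : Fin 1 ⊕ Fin 3), p ≠ Sum.inr 2 → realEmb M Φ φ (u p) = Complex.I := by
    intro φ p hp
    rw [hu_def]
    rcases p with p | k
    · simp only [Sum.elim_inl, mul_one, realEmb_iPhiVal]
    · have hk : k ≠ 2 := fun h => hp (by rw [h])
      simp only [Sum.elim_inr, if_neg hk, mul_one, realEmb_iPhiVal]
  have hu2 : u (Sum.inr 2) =
      iPhiVal M Φ * (realPiEquiv M Φ).symm (fun φ => if φ.1.comp j = τ then (-1 : ℂ) else 1) := by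
    rw [hu_def]
    dsimp only
    rw [Sum.elim_inr, if_pos rfl]
  have hval1 : ∀ φ : Φ.1, φ.1.comp j = τ → realEmb M Φ φ (u (Sum.inr 2)) = -Complex.I := by
    intro φ hφ
    rw [hu2, map_mul, realEmb_iPhiVal, realEmb_apply, realPi_symm_apply, if_pos hφ, mul_neg, mul_one]
  have hval2 : ∀ φ : Φ.1, φ.1.comp j ≠ τ → realEmb M Φ φ (u (Sum.inr 2)) = Complex.I := by
    intro φ hφ
    rw [hu2, map_mul, realEmb_iPhiVal, realEmb_apply, realPi_symm_apply, if_neg hφ, mul_one]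
  refine ⟨fun y => ?_, fun i ρ v hv => ?_⟩
  · rw [hJ]
    exact auxComplexStructure_mul_actMatrix_comm F τ Φ T x (blockGL M (1, B)) c hc u hu y
  · have hJv : (J : Matrix (Fin g ⊕ Fin g) (Fin g ⊕ Fin g) ℝ).map (algebraMap ℝ ℂ) *ᵥ v =
        (∑ k, (((Algebra.TensorProduct.basis ℝ (ratBasis M)).repr (u i) k : ℝ) : ℂ) * ρ (ratBasis M k)) • v := by
      rw [hJ]
      exact auxComplexStructure_map_mulVec_eq F τ Φ T x (blockGL M (1, B)) c hc u hu i ρ v hv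
    by_cases hρ : ρ ∈ Φ.1
    · rw [sum_repr_mul_eq_realEmb Φ ⟨ρ, hρ⟩ (u i)] at hJv
      by_cases hi : i = Sum.inr 2
      · subst hi
        constructor
        · intro hmem
          rw [hΦ'₂] at hmem
          have hne : ρ.comp j ≠ τ := by
            rcases hmem with ⟨_, hne⟩ | heq
            · exact hne
            · intro h
              rw [h] at heq
              exact hτ heq.symm
          rwa [hval2 ⟨ρ, hρ⟩ hne] at hJv
        · intro hnot
          rw [hΦ'₂, not_or] at hnot
          have heq : ρ.comp j = τ := by
            by_contra hne
            exact hnot.1 ⟨hρ, hne⟩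
          rwa [hval1 ⟨ρ, hρ⟩ heq] at hJv
      · rw [hval0 ⟨ρ, hρ⟩ i hi] at hJv
        rw [hΦ'₁ i hi]
        exact ⟨fun _ => hJv, fun hnot => absurd hρ hnot⟩
    · have hρ' : ComplexEmbedding.conjugate ρ ∈ Φ.1 := by
        by_contra h'
        exact hρ ((Φ.2 ρ).2 h')
      rw [sum_repr_mul_eq_conj_realEmb Φ ρ hρ' (u i)] at hJv
      by_cases hi : i = Sum.inr 2
      · subst hi
        have hiff : (ComplexEmbedding.conjugate ρ).comp j = τ ↔ ρ.comp j = ComplexEmbedding.conjugate τ := by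
          constructor
          · intro h
            rw [← h]
            exact (hinv (ρ.comp j)).symm
          · intro h
            change ComplexEmbedding.conjugate (ρ.comp j) = τ
            rw [h]
            exact hinv τ
        constructor
        · intro hmem
          rw [hΦ'₂] at hmem
          have heq : ρ.comp j = ComplexEmbedding.conjugate τ := by
            rcases hmem with ⟨hmemΦ, _⟩ | heq
            · exact absurd hmemΦ hρ
            · exact heq
          rw [hval1 ⟨ComplexEmbedding.conjugate ρ, hρ'⟩ (hiff.2 heq)] at hJv
          rw [hJv, map_neg, Complex.conj_I, neg_neg]
        · intro hnot
          rw [hΦ'₂, not_or] at hnot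
          have hne : ¬ (ComplexEmbedding.conjugate ρ).comp j = τ := fun h => hnot.2 (hiff.1 h)
          rw [hval2 ⟨ComplexEmbedding.conjugate ρ, hρ'⟩ hne] at hJv
          rw [hJv, Complex.conj_I]
      · rw [hval0 ⟨ComplexEmbedding.conjugate ρ, hρ'⟩ i hi] at hJv
        rw [hΦ'₁ i hi]
        refine ⟨fun hmem => absurd hmem hρ, fun _ => ?_⟩
        rw [hJv, Complex.conj_I]


end SpecialPair

end Literature.AlgebraicGeometry.ShimuraVarieties.UnitaryCanonicalModel.Aux

end
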